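import Mathlib
import HarnessLib
import Literature.Probability.MarkovChains.MetropolisHastings
import Literature.Probability.MarkovChains.TotalVariation
import Literature.Probability.MarkovChains.MengersenTweedie
import Summits.Ventures.LatticeQCDFlow.Exactness.FlowMCMC
import Summits.Ventures.LatticeQCDFlow.Exactness.JarzynskiFinite
import Summits.Ventures.LatticeQCDFlow.Scaling.ImportanceWeights
import Summits.Ventures.LatticeQCDFlow.Scaling.Barriers
import Summits.Ventures.LatticeQCDFlow.TrivializingMaps.TheoremA
import Summits.Ventures.LatticeQCDFlow.TrivializingMaps.AnchoredTheoremA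
import Literature.MathematicalPhysics.QuantumFieldTheory.Luscher2010.FlowExistenceProofs
import Literature.MathematicalPhysics.QuantumFieldTheory.Luscher2010.FlowActionSeriesProofs
import Literature.MathematicalPhysics.QuantumFieldTheory.Luscher2010.EulerStepProofs
import Summits.Ventures.LatticeQCDFlow.TrivializingMaps.JacobianFormula
import Summits.Ventures.LatticeQCDFlow.TrivializingMaps.LuscherSection3Unconditional
import Summits.Ventures.LatticeQCDFlow.TrivializingMaps.LoopActionSeriesLowDim
import Summits.Ventures.LatticeQCDFlow.TrivializingMaps.WilsonFlowActionSeries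
import Summits.Ventures.LatticeQCDFlow.TrivializingMaps.StrongCouplingTrivializingMap
import Summits.Ventures.LatticeQCDFlow.TrivializingMaps.WilsonMeasureTrivializingMap

/-!
# Venture statement — LatticeQCDFlow (cell `pub-lqcd`, `lqcd-flow`) — DRAFT

HONEST FRAMING: exact (Metropolis-corrected) sampling algorithms for lattice gauge theory;
figures of merit are autocorrelation/cost numbers at stated couplings and volumes; no
continuum-physics claim.

This is the venture's `Statement.lean` DRAFT (FANOUT-PLAN.md row 31; review-queued; it STAYS A
DRAFT until the operator adopts it).  The text between the rules is the binding part of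
`HOME/VENTURE-STATEMENT.md` DRAFT v0.4 (2026-08-21T00:55:27Z, gen-5 lead; sha256 75a0bda75d009414)
VERBATIM; the version history, the file-placement table and the DELTA blocks of that file are
not repeated here (they are bookkeeping of the scoping phase and change nothing below).

---
This venture bears on NO summit statement (tribunal T1: venture, not QuantumFields-summit-bearing).
Its Lean content is (E) exactness theorems that define "exact sampler", (S) scaling lemmas that
type the volume barrier, (T) Lüscher's trivializing-map results as CITED Literature statements
plus his open infinite-volume question as a CONJECTURE item. Placement rule (binding):
`lean/Literature/**` = published, cited statements only (cite tags); everything new under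
`lean/Summits/Ventures/LatticeQCDFlow/<Topic>/…` with Topic ∈ {Exactness, Scaling,
TrivializingMaps} (first folder under the topic is NOT Theorems/Theses/Cruxes/Ideas/Statement/
_closed); `Summits/Ventures/LatticeQCDFlow/Statement.lean` may be proposed as a review-queued
DRAFT and stays draft until the operator adopts it.

`Statement.lean` (Venture, DRAFT, review-queued, stays draft): the conjunction the venture would
certify if R1 lands — "there is an exact sampler (IMH / NE-reweighting, E1/E4) whose measured
Eff(Q²) at P1 …" — is NOT a Lean statement; the Venture Statement is the THEORY conjunction
E1 ∧ E4 ∧ S1 ∧ S3′ ∧ (VolumeScalingOfTraining typed), with the numerical programme referenced in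
the docstring only.
---

The numerical programme (ladder STEP-0 → R1a → R1 → R2; frozen fitness = τ_int(Q)-per-cost and
ESS-per-cost at stated (β, L); exactness a hard constraint) is HOME/SCOPING.md and is not a Lean
object.  Below, namespace `Summit.Ventures.LatticeQCDFlow` states the theory-side conjuncts as
`Prop`s over the LANDED substrate, each docstring naming the declaration that proves it (or OPEN
and who owns it), followed by its discharge `…_holds` where the proof is in the tree.  Finite
state spaces throughout (configuration space `X` a `Fintype`; laws as positive vectors summing
to `1`; the flow-MCMC chain is `Exactness.imhKernel p q = mhKernel (fun _ y => q y) p`).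

This first landing carries E1, E2, E4, S1, S2, S3′.  To be APPENDED (file is append-only) as
their files land: E3 (flow push-forward / change of variables, row 30's
`Exactness/FlowPushforward.lean`, review-queued), B1 `Barriers.VolumeScalingOfTraining` (row 31's
`Scaling/Barriers.lean`, after `Scaling/{LocalFlows, BlockDefect, Bhattacharyya}.lean`), the
T-side conjecture item C1 `LuscherUniformRadius` (`TrivializingMaps/`, rows 28/30), and last the
conjunction `Statement := E1 ∧ E4 ∧ S1 ∧ S3′ ∧ B1` itself (a `def` body cannot change after
landing, so it is written once all conjuncts exist).  Nothing here is vacuous: every `Prop`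
quantifies over all finite state spaces and all laws of the stated kind.
-/

namespace Summit.Ventures.LatticeQCDFlow

open Finset
open Literature.Probability.MarkovChains
open Summit.Ventures.LatticeQCDFlow.Exactness
open Summit.Ventures.LatticeQCDFlow.Theory2

/-! ### Part E — exactness -/

/-- **E1 (`IMHExact`): the flow sampler with accept/reject is EXACT for every model.**  For every
finite configuration space, every positive target `p` and every proposal law `q ≥ 0` with
`Σ q = 1`, the flow-MCMC chain `imhKernel p q` (propose `y ∼ q` independently of the state,
accept with `min {1, p y q x / (p x q y)}`) is a stochastic matrix in detailed balance with `p` —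
whatever the quality of `q` (Albergo–Kanwar–Shanahan 2019; Kanwar et al. 2020 "provably
correct").  PROVED: `Exactness.imhKernel_detailedBalance`, `Exactness.imhKernel_isRowStochastic`
(`Exactness/FlowMCMC.lean`, row 30; one-liners over the tree's
`Literature.Probability.MarkovChains.mhKernel_detailedBalance`). -/
def E1_IMHExact : Prop :=
  ∀ (X : Type) [Fintype X] [DecidableEq X] (p q : X → ℝ),
    (∀ x, 0 < p x) → (∀ x, 0 ≤ q x) → ∑ x, q x = 1 →
    IsRowStochastic (imhKernel p q) ∧ DetailedBalance p (imhKernel p q)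

/-- E1 holds (row 30's `Exactness/FlowMCMC.lean`). -/
theorem E1_IMHExact_holds : E1_IMHExact :=
  fun _ _ _ _ q hp hq hq1 => ⟨imhKernel_isRowStochastic hp hq hq1, imhKernel_detailedBalance hp q⟩

/-- **E2 (`DetailedBalanceImpliesStationary`).**  Detailed balance and unit row sums imply
stationarity (finite version of Mathlib's `Kernel.IsReversible.invariant`).  IN TREE:
`Literature.Probability.MarkovChains.DetailedBalance.isStationary` (cited, not re-filed); for
the flow-MCMC chain directly `Exactness.imhKernel_isStationary`. -/
def E2_DetailedBalanceStationary : Prop :=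
  ∀ (X : Type) [Fintype X] [DecidableEq X] (π : X → ℝ) (P : X → X → ℝ),
    DetailedBalance π P → (∀ x, ∑ y, P x y = 1) → IsStationary π P

/-- E2 holds (tree: `DetailedBalance.isStationary`). -/
theorem E2_DetailedBalanceStationary_holds : E2_DetailedBalanceStationary :=
  fun _ _ _ _ _ h hrow => h.isStationary hrow

/-- **E4 (`JarzynskiFinite`): the identity that makes NE-MCMC / stochastic-normalizing-flow
reweighting exact.**  For a protocol of actions `S₀, …, S_n` on a finite configuration space and
kernels `P₁, …, P_n` with `P_k` leaving `exp(−S_k)` STATIONARY (no detailed balance, no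
row-stochasticity needed for the identity), the path average of `exp(−W)`,
`W = Σ_k (S_k − S_{k−1})(x_{k−1})`, started from `π₀ = e^{−S₀}/Z₀`, equals `Z_n/Z₀`
(Jarzynski 1997; Neal 2001; Caselle et al. 2016; Bonanno et al. arXiv:2510.25704 §2).  Stated
over row 30's vocabulary (`Exactness.pathLaw`, `gibbsLaw`, `work`, `partitionFn` of
`Exactness/JarzynskiFinite.lean`).  PROVED: `Exactness.jarzynski` (row 30); a second, independent
proof is theory2's `jarzynskiFinite` (HOME/THEORY-2-Sketch.lean v1.5, path-space form). -/
def E4_JarzynskiFinite : Prop :=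
  ∀ (X : Type) [Fintype X] (n : ℕ) (S : Fin (n + 1) → X → ℝ) (P : Fin n → X → X → ℝ),
    (∀ k : Fin n, IsStationary (fun x => Real.exp (-S k.succ x)) (P k)) →
    ∑ x : Fin (n + 1) → X, pathLaw (gibbsLaw (S 0)) P x * Real.exp (-work S x) =
      partitionFn (S (Fin.last n)) / partitionFn (S 0)

/-- E4 holds (row 30's `Exactness.jarzynski`). -/
theorem E4_JarzynskiFinite_holds : E4_JarzynskiFinite :=
  fun _ _ _ S P hP => jarzynski S P hP

/-! ### Part S — scaling / barriers -/

/-- **S1 (`ESSProductLaw`): the volume law in the factorised MODEL.**  If target and model both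
factorise over `m` identical independent blocks, the reweighting effective-sample-size fraction
is `ESS(m blocks) = ESS(1 block)^m` exactly — with `V = m·V₀` this is
"ESS(V) = ESS(V₀)^{V/V₀}" (Abbott et al. 2022, arXiv:2211.07541 §V; Finkenrath 2022) as a theorem
about product laws, labelled as such.  PROVED: `Theory2.essFrac_blockProd_const` (general blocks:
`Theory2.essFrac_blockProd`, two blocks `Theory2.essFrac_prodLaw`; `Scaling/ImportanceWeights.lean`,
row 31).  The lower-bound version for ANY finite-range flow of a product prior is B1 below
(`Scaling/Barriers.lean`). -/
def S1_ESSProductLaw : Prop :=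
  ∀ (Z : Type) [Fintype Z] (p₀ q₀ : Z → ℝ) (m : ℕ), (∀ z, 0 < q₀ z) → ∑ z, p₀ z = 1 →
    essFrac (blockProd fun _ : Fin m => p₀) (blockProd fun _ : Fin m => q₀) = essFrac p₀ q₀ ^ m

/-- S1 holds (`Theory2.essFrac_blockProd_const`). -/
theorem S1_ESSProductLaw_holds : S1_ESSProductLaw :=
  fun _ _ _ _ m hq hp1 => essFrac_blockProd_const hq hp1 m

/-- **S2 (`IMHRelaxation`, Mengersen–Tweedie): the relaxation time of the exact flow-MCMC chain
is `w⋆ = max p/q`, neither more nor less.**  If `p ≤ W·q` pointwise then from every initial law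
`‖μPᵗ − p‖_TV ≤ (1 − 1/W)ᵗ` [Mengersen–Tweedie 1996, Thm 2.1], and if `W` is attained at a
configuration `x⋆` (`p x⋆ = W q x⋆`) the chain started there has
`‖δ_{x⋆}Pᵗ − p‖_TV = (1 − 1/W)ᵗ (1 − p x⋆)` exactly [Wang 2022, Thm 2; Liu 1996].  For a
`V/V₀`-fold product model `w⋆ = (w⋆₁)^{V/V₀}`: exponential in the volume at fixed local model
quality — the typed form of barrier B1 for full-lattice independence samplers (lead's V2).
PROVED: `Literature.Probability.MarkovChains.imh_tvDist_lawAt_le`, `imh_tvDist_lawAt_mode`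
(`Literature/Probability/MarkovChains/MengersenTweedie.lean`, row 31). -/
def S2_IMHRelaxation : Prop :=
  ∀ (X : Type) [Fintype X] [DecidableEq X] (p q : X → ℝ) (W : ℝ),
    (∀ x, 0 < p x) → ∑ x, p x = 1 → (∀ x, 0 ≤ q x) → ∑ x, q x = 1 → (∀ x, p x ≤ W * q x) →
    (∀ (μ : X → ℝ), (∀ x, 0 ≤ μ x) → ∑ x, μ x = 1 → ∀ t : ℕ,
        tvDist (lawAt (imhKernel p q) μ t) p ≤ (1 - W⁻¹) ^ t) ∧
    (∀ xs : X, p xs = W * q xs → ∀ t : ℕ,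
        tvDist (lawAt (imhKernel p q) (Pi.single xs 1) t) p = (1 - W⁻¹) ^ t * (1 - p xs))

/-- S2 holds (`imh_tvDist_lawAt_le`, `imh_tvDist_lawAt_mode`; `imhKernel` unfolds to the
tree's `mhKernel (fun _ y => q y) p` by `rfl`). -/
theorem S2_IMHRelaxation_holds : S2_IMHRelaxation :=
  fun _ _ _ _ _ _ hp hp1 hq hq1 hW =>
    ⟨fun _ hμ hμ1 t => imh_tvDist_lawAt_le hp hp1 hq hq1 hW hμ hμ1 t,
     fun _ hxs t => imh_tvDist_lawAt_mode hp hp1 hq hq1 hW hxs t⟩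

/-- **S3′ (`IMHSectorMixingFloor`, mode collapse): a topological sector the model under-weights
freezes the EXACT chain.**  If the chain started from `μ` is `ε`-close to `p` in total variation
at time `t`, then for every set `A` of configurations (a topological sector, say)
`p(A) − μ(A) − ε ≤ t · q(A)`: reaching a sector of target mass `p(A)` from model mass `q(A)`
costs `t ≥ (p(A) − μ(A) − ε)/q(A)` steps, whatever the mean acceptance (Nicoli et al. 2023;
the lead's S3/S3′).  PROVED: `Exactness.imh_sector_mixing_lower_bound` (row 30; one-step entry
bound `Exactness.imhKernel_sum_le_of_not_mem`); the autocorrelation form is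
`Exactness.sector_joint_lower_bound` (`Barriers.SectorStickingFloor`). -/
def S3_IMHSectorMixingFloor : Prop :=
  ∀ (X : Type) [Fintype X] [DecidableEq X] (p q μ : X → ℝ) (A : Finset X) (t : ℕ) (ε : ℝ),
    (∀ x, 0 < p x) → ∑ x, p x = 1 → (∀ x, 0 ≤ q x) → ∑ x, q x = 1 → (∀ x, 0 ≤ μ x) →
    ∑ x, μ x = 1 → tvDist (lawAt (imhKernel p q) μ t) p ≤ ε →
    (∑ y ∈ A, p y) - (∑ y ∈ A, μ y) - ε ≤ t * ∑ y ∈ A, q y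

/-- S3′ holds (`Exactness.imh_sector_mixing_lower_bound`). -/
theorem S3_IMHSectorMixingFloor_holds : S3_IMHSectorMixingFloor :=
  fun _ _ _ _ _ _ A _ _ hp hp1 hq hq1 hμ hμ1 h =>
    imh_sector_mixing_lower_bound hp hp1 hq hq1 hμ hμ1 A h

/-! ### Part S — the volume barrier B1, and the theory conjunction of record (appended) -/

/-- **B1 (`VolumeScalingOfTraining`): the volume barrier for fixed-receptive-field flows, TYPED
AND PROVED.**  `Barriers.VolumeScalingOfTraining := LocalPushforwardFactorises ∧
KLSuperadditiveFin ∧ BlockDefectVolumeLaw ∧ AccBlockDefectVolumeLaw` (`Scaling/Barriers.lean`,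
row 31; cores in `Scaling/{LocalFlows, BlockDefect, Bhattacharyya}.lean`): a depth-`k`,
footprint-`r` flow of a product prior leaves blocks `> 2kr` apart independent (light cone), the
forward KL is superadditive over independent blocks, so `m` blocks with per-block total-variation
defect `≥ δ` force `D_KL(p‖q) ≥ 2mδ²` (hence `ESS ≤ e^{−2mδ²}`) and acceptance `≤ e^{−mδ²}` —
exponential in the volume at fixed block size.  The physics input (a volume-uniform block
defect `δ(β, R) > 0` of the Wilson law, hypothesis (U)/(U′) = `Conjectures.CrossCutCorrelatorFloor`)
is NOT part of the `def`.  PROVED: `Barriers.volumeScalingOfTraining`. -/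
def B1_VolumeScalingOfTraining : Prop := Barriers.VolumeScalingOfTraining

/-- B1 holds (`Barriers.volumeScalingOfTraining`). -/
theorem B1_VolumeScalingOfTraining_holds : B1_VolumeScalingOfTraining :=
  Barriers.volumeScalingOfTraining

/-- **The theory conjunction of record** (HOME/VENTURE-STATEMENT.md DRAFT v0.4: "the Venture
Statement is the THEORY conjunction E1 ∧ E4 ∧ S1 ∧ S3′ ∧ (VolumeScalingOfTraining typed)"):
exactness of flow-MCMC for every model (E1), Jarzynski's identity for NE-MCMC reweighting (E4),
the ESS product law (S1), the sector mixing floor (S3′) and the typed volume barrier (B1).  All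
five conjuncts are theorems in the tree (`TheoryStatement_holds`); what the venture would CERTIFY
beyond them is numerical (the ladder STEP-0 → R1a → R1 of HOME/SCOPING.md, frozen fitness
τ_int(Q)-per-cost / ESS-per-cost at stated (β, L)) and is not a Lean object; the venture's OPEN
Lean items are the conjecture items `Conjectures.{LaplaceHalfMass, CrossCutCorrelatorFloor,
ExactTransportBiLipschitz}` (`Scaling/Conjectures.lean`) and theory-1's
`TrivializingMaps.LuscherUniformRadius` (C1) with the typed targets of
`TrivializingMaps/Truncation.lean` — referenced here, deliberately not conjoined.  Named
`TheoryStatement` (not `Statement`) so that the operator's adoption can define the venture's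
statement of record freely; this file stays a DRAFT until then. -/
def TheoryStatement : Prop :=
  E1_IMHExact ∧ E4_JarzynskiFinite ∧ S1_ESSProductLaw ∧ S3_IMHSectorMixingFloor ∧
    B1_VolumeScalingOfTraining

/-- The theory conjunction holds. -/
theorem TheoryStatement_holds : TheoryStatement :=
  ⟨E1_IMHExact_holds, E4_JarzynskiFinite_holds, S1_ESSProductLaw_holds,
    S3_IMHSectorMixingFloor_holds, B1_VolumeScalingOfTraining_holds⟩

/-! ### Part T — trivializing maps (theory-1's Lüscher-series programme; APPENDED 2026-08-21 by row 30)

The T-side items the module docstring defers ("the T-side conjecture item C1 `LuscherUniformRadius`")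
are THEOREMS in the tree since theory-1 GEN-10's graded-series chain (`TrivializingMaps/GradedTheoremA.lean`,
`luscherGeometricGradientBound_holds`) and row 30's corollary files (`TrivializingMaps/TheoremA.lean`,
`TrivializingMaps/AnchoredTheoremA.lean`).  They are stated here as `Prop`s quantified over every dimension
`d`, every `SU(n)` and (for C1) every coupling `β`, each discharged; `TheoryStatementT` conjoins them with
`TheoryStatement`.  All three concern Lüscher's FORMAL power series on finite periodic lattices (a
volume-uniform radius for the link-gradient series) — no continuum claim. -/

/-- **T1 (THEOREM A, `LuscherGeometricGradientBound`).**  For every `d` and `n` there are `ρ > 0` and `C`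
such that for every lattice size `L`, every orthonormal basis of `𝔰𝔲(n)` and every smooth solution of
Lüscher's recursion for the Wilson plaquette action, `|∂^a_e S̃^{(k)}(ιU)| ≤ C ρ^{-k}` — Lüscher 2010
§4.5(b)'s observed geometric behaviour, as a theorem uniform in the volume
(`TrivializingMaps/Truncation.lean` §6; proved by `GradedSeries.luscherGeometricGradientBound_holds`). -/
def T1_TheoremA : Prop := ∀ d n : ℕ, TrivializingMaps.LuscherGeometricGradientBound d n

/-- T1 holds (`TrivializingMaps/GradedTheoremA.lean`, theory-1 GEN-10). -/
theorem T1_TheoremA_holds : T1_TheoremA :=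
  fun d n => TrivializingMaps.GradedSeries.luscherGeometricGradientBound_holds d n

/-- **T2 (C1, `LuscherUniformRadius`): Lüscher's volume-uniform radius at every coupling.**  For every
`d`, `n`, `β` there is `r > 0` such that for every lattice size, basis and smooth solution of the recursion
for `β·S_W`, the link-gradient series `∑_k |t|^k |∂^a_e S̃^{(k)}(ιU)|` converges for `|t| < r`
(`TrivializingMaps/UniformRadius.lean`; proved by `TrivializingMaps.luscherUniformRadius_holds`). -/
def T2_LuscherUniformRadius : Prop := ∀ (d n : ℕ) (β : ℝ), TrivializingMaps.LuscherUniformRadius d n β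

/-- T2 holds (`TrivializingMaps/TheoremA.lean`, row 30). -/
theorem T2_LuscherUniformRadius_holds : T2_LuscherUniformRadius :=
  fun d n β => TrivializingMaps.luscherUniformRadius_holds d n β

/-- **T3 (the ANCHORED, local form of Theorem A, `LuscherAnchoredGeometricBound`).**  For every `d`, `n`
and orthonormal basis `B₀` of `𝔰𝔲(n)`, the anchored terms `G^{(k)}_{e₀}` of the constructed Lüscher series
(`S̃^{(k)} = ∑_{e₀} G^{(k)}_{e₀}`, each supported on the plaquette ball of radius `k+1` about its anchor)
obey `|∂^a_e G^{(k)}_{e₀}(ιU)| ≤ C ρ^{-k}` with `ρ, C` independent of the lattice size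
(`TrivializingMaps/TheoremAReduction.lean`; proved by `GradedSeries.luscherAnchoredGeometricBound_holds`). -/
def T3_AnchoredTheoremA : Prop :=
  ∀ (d n : ℕ) (B₀ : Literature.MathematicalPhysics.QuantumFieldTheory.Luscher2010.SuBasis n),
    TrivializingMaps.LuscherAnchoredGeometricBound d n B₀

/-- T3 holds (`TrivializingMaps/AnchoredTheoremA.lean`, row 30). -/
theorem T3_AnchoredTheoremA_holds : T3_AnchoredTheoremA :=
  fun d n B₀ => TrivializingMaps.GradedSeries.luscherAnchoredGeometricBound_holds d n B₀

/-- **The theory conjunction with the T-side** (DRAFT, for the operator's adoption as before):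
`TheoryStatement ∧ T1 ∧ T2 ∧ T3`. -/
def TheoryStatementT : Prop :=
  TheoryStatement ∧ T1_TheoremA ∧ T2_LuscherUniformRadius ∧ T3_AnchoredTheoremA

/-- The extended theory conjunction holds. -/
theorem TheoryStatementT_holds : TheoryStatementT :=
  ⟨TheoryStatement_holds, T1_TheoremA_holds, T2_LuscherUniformRadius_holds, T3_AnchoredTheoremA_holds⟩

/-! ### Part T, continued — Lüscher's finite-lattice statements, CITED in `Literature/…/Luscher2010/` and
DISCHARGED in the tree (APPENDED 2026-08-21 by row 31)

The module docstring's "(T) Lüscher's trivializing-map results as CITED Literature statements": of the nine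
`def … : Prop` named facts of `Luscher2010/TrivializingMaps.lean` (file A) and `Luscher2010/FlowActionSeries.lean`
(file B), SIX are now theorems — `FlowGlobalExistence` (§3.1; `Luscher2010/FlowExistenceProofs.lean`),
`JacobianFormula` (eq. (3.9); `TrivializingMaps/JacobianFormula.lean`), `TrivializingFlowCriterion`
(eqs. (4.1)–(4.3); `TrivializingMaps/LuscherSection3Unconditional.lean`), `PlaquetteLaplacian` (eqs. (3.10),
(4.14); `Luscher2010/FlowActionSeriesProofs.lean`), `EulerStepInvertible` (§5.2, App. D;
`Luscher2010/EulerStepProofs.lean`) and `LuscherSeriesLocal` (§4.5(b), every Wilson-loop action;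
`TrivializingMaps/LoopActionSeriesLowDim.lean`) — and THREE stay cited: `TrivializingMapExists` (Moser's
theorem), `TrivializingFlowExists` (App. E: elliptic solvability of `𝓛_t S̃_t = S + Ċ_t`) and
`SeriesConvergesFiniteVolume` (App. E: Sobolev estimates), the inputs needing elliptic regularity on the
compact field manifold.  `T4` conjoins the six over every dimension, lattice size and `SU(n)`. -/

/-- **T4 (Lüscher 2010's finite-lattice statements that are theorems in the tree).**  For every `d`, every
`L` and every `n`: global existence/uniqueness/continuity of the flow of a `C¹` tangent generator on `SU(n)^E`
(§3.1), the Jacobian formula (3.9), the trivializing-flow criterion (4.1)–(4.3), the plaquette Laplacian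
identity behind (3.10)/(4.14), invertibility of the one-link Euler step (§5.2, `d = 4`, `SU(3)`, `|ε| < 1/8`,
`L ≥ 2`), and finite-order locality of the Lüscher series of every Wilson-loop action (§4.5(b)) — each the
cited `Prop` of `Literature/…/Luscher2010/` verbatim. -/
def T4_LuscherFiniteLattice : Prop :=
  ∀ d L n : ℕ,
    Literature.MathematicalPhysics.QuantumFieldTheory.Luscher2010.FlowGlobalExistence d L n ∧
    Literature.MathematicalPhysics.QuantumFieldTheory.Luscher2010.JacobianFormula d L n ∧
    Literature.MathematicalPhysics.QuantumFieldTheory.Luscher2010.TrivializingFlowCriterion d L n ∧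
    Literature.MathematicalPhysics.QuantumFieldTheory.Luscher2010.PlaquetteLaplacian d L n ∧
    Literature.MathematicalPhysics.QuantumFieldTheory.Luscher2010.EulerStepInvertible L ∧
    Literature.MathematicalPhysics.QuantumFieldTheory.Luscher2010.LuscherSeriesLocal d n

/-- T4 holds (`flowGlobalExistence_holds`, `jacobianFormula_holds`, `trivializingFlowCriterion_holds`,
`plaquetteLaplacian_holds`, `eulerStepInvertible_holds`, `luscherSeriesLocal_holds`; rows 28/31). -/
theorem T4_LuscherFiniteLattice_holds : T4_LuscherFiniteLattice :=
  fun d _ n =>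
    ⟨Literature.MathematicalPhysics.QuantumFieldTheory.Luscher2010.flowGlobalExistence_holds,
      TrivializingMaps.jacobianFormula_holds,
      TrivializingMaps.trivializingFlowCriterion_holds,
      Literature.MathematicalPhysics.QuantumFieldTheory.Luscher2010.plaquetteLaplacian_holds,
      Literature.MathematicalPhysics.QuantumFieldTheory.Luscher2010.eulerStepInvertible_holds,
      TrivializingMaps.luscherSeriesLocal_holds d n⟩

/-- **The theory conjunction with the whole T-side** (DRAFT, for the operator's adoption as before):
`TheoryStatementT ∧ T4`. -/
def TheoryStatementT4 : Prop :=
  TheoryStatementT ∧ T4_LuscherFiniteLattice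

/-- The extended theory conjunction holds. -/
theorem TheoryStatementT4_holds : TheoryStatementT4 :=
  ⟨TheoryStatementT_holds, T4_LuscherFiniteLattice_holds⟩

/-! ### Part T, continued — summing Lüscher's series for `β·S_W` (APPENDED 2026-08-21, row 31 GEN-4): the content
of the three still-CITED Lüscher statements, PROVED for the Wilson action in a volume-uniform strong-coupling window
(`TrivializingMaps/{SeriesSummation, …, StrongCouplingTrivializingMap, WilsonMeasureTrivializingMap}.lean`). -/

section PartT5

open Literature.MathematicalPhysics.QuantumFieldTheory
open Literature.MathematicalPhysics.QuantumFieldTheory.Luscher2010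
open scoped Matrix Matrix.Norms.Frobenius ContDiff

/-- **T5 (the summed Lüscher series of `β·S_W` converges and solves (4.5), `L`-independent radius)**: the body
of the cited `SeriesConvergesFiniteVolume` (App. E) for `S = β·S_W`, for every smooth Haar-normalised series. -/
def T5_WilsonSeriesConverges : Prop :=
  ∀ (d n : ℕ), n ≠ 0 → ∀ (B : SuBasis n) (β : ℝ),
    ∃ r : ℝ, 0 < r ∧ ∀ (L : ℕ) [NeZero L] (Sk : ℕ → AmbConfig d L n → ℝ) (c : ℕ → ℝ),
      (∀ k, ContDiff ℝ (⊤ : ℕ∞) (Sk k)) →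
      IsLuscherSeries B (fun W => β * TrivializingMaps.ambWilsonAction W) Sk c →
      IsHaarNormalised Sk →
      ∀ t : ℝ, |t| < r →
        (∀ U : GaugeConfig d L (Matrix.specialUnitaryGroup (Fin n) ℂ),
          Summable fun k => |t| ^ k * |Sk k (WilsonFlow.coeConfig U)|) ∧
        (∀ (U : GaugeConfig d L (Matrix.specialUnitaryGroup (Fin n) ℂ)) (e : Edge d L) (a : B.ι),
          Summable fun k => |t| ^ k * |linkDeriv e (B.T a) (Sk k) (WilsonFlow.coeConfig U)|) ∧
        (Summable fun k => |t| ^ k * |c k|) ∧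
        ∀ U : GaugeConfig d L (Matrix.specialUnitaryGroup (Fin n) ℂ),
          luscherL B (fun W => β * TrivializingMaps.ambWilsonAction W) t (fun W => ∑' k, t ^ k * Sk k W)
              (WilsonFlow.coeConfig U) =
            β * TrivializingMaps.ambWilsonAction (WilsonFlow.coeConfig U) + ∑' k, t ^ k * c k

/-- T5 holds (`TrivializingMaps.GradedSeries.seriesConverges_smul_ambWilsonAction`, row 31 GEN-4). -/
theorem T5_WilsonSeriesConverges_holds : T5_WilsonSeriesConverges := fun _ _ hn B β =>
  TrivializingMaps.GradedSeries.seriesConverges_smul_ambWilsonAction B hn β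

/-- **T6 (trivializing maps for the SU(n) Wilson theory at strong coupling, every volume)**: for every `d`,
`n ≠ 0` and orthonormal basis `B` of `𝔰𝔲(n)` there is `β₀ > 0` INDEPENDENT OF `L` such that for every `L` and
`|β| < β₀` a continuous gauge-equivariant `𝓕` has `𝓕_* D[V] = 𝒵⁻¹ e^{-β S_W} D[U] = wilsonMeasure ρ₀ β`. -/
def T6_StrongCouplingTrivializingMap : Prop :=
  ∀ (d n : ℕ), n ≠ 0 → ∀ (_ : SuBasis n),
    ∃ β₀ : ℝ, 0 < β₀ ∧ ∀ (L : ℕ) [NeZero L] (β : ℝ), |β| < β₀ →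
      ∃ F : GaugeConfig d L (Matrix.specialUnitaryGroup (Fin n) ℂ) →
          GaugeConfig d L (Matrix.specialUnitaryGroup (Fin n) ℂ),
        Continuous F ∧ IsGaugeEquivariant F ∧
        IsTrivializingMap
          (fun U : GaugeConfig d L (Matrix.specialUnitaryGroup (Fin n) ℂ) =>
            β * TrivializingMaps.ambWilsonAction (WilsonFlow.coeConfig U)) F ∧
        MeasureTheory.Measure.map F
            (MeasureTheory.Measure.pi fun _ : Edge d L =>
              haarProbability (Matrix.specialUnitaryGroup (Fin n) ℂ)) =
          wilsonMeasure (d := d) (L := L) (TrivializingMaps.StrongCoupling.defRep n) β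

/-- T6 holds (`StrongCoupling.exists_isTrivializingMap_smul_ambWilsonAction` + `boltzmannMeasure_smul_ambWilsonAction`). -/
theorem T6_StrongCouplingTrivializingMap_holds : T6_StrongCouplingTrivializingMap := fun d n hn B => by
  obtain ⟨β₀, hβ₀, h⟩ := TrivializingMaps.StrongCoupling.exists_isTrivializingMap_smul_ambWilsonAction (d := d) hn B
  refine ⟨β₀, hβ₀, fun L _ β hβ => ?_⟩
  obtain ⟨F, hF, hG, htriv⟩ := h L β hβ
  exact ⟨F, hF, hG, htriv,
    (TrivializingMaps.StrongCoupling.boltzmannMeasure_smul_ambWilsonAction (d := d) (L := L) β) ▸ htriv.2⟩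

end PartT5

/-- **The theory conjunction with the summed-series theorems** (DRAFT): `TheoryStatementT4 ∧ T5 ∧ T6`. -/
def TheoryStatementT6 : Prop := TheoryStatementT4 ∧ T5_WilsonSeriesConverges ∧ T6_StrongCouplingTrivializingMap

/-- The extended theory conjunction holds. -/
theorem TheoryStatementT6_holds : TheoryStatementT6 :=
  ⟨TheoryStatementT4_holds, T5_WilsonSeriesConverges_holds, T6_StrongCouplingTrivializingMap_holds⟩

end Summit.Ventures.LatticeQCDFlow
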